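import Literature.NumberTheory.GaloisRepresentations.LocalRingToClosureValuationSubring
import HarnessLib

/-!
# Places above `v` of a domain ALGEBRAIC over `𝓞ᵥ` come from `𝓞ᵥ`-maps into `𝒪_{\bar K_v}` — prime-ideal form
# ([Neukirch 1999] Ch. II §8 (8.1); [Liu2002] Lemma 10.1.32 / Cor. 10.1.38)

Topic `Literature/NumberTheory/GaloisRepresentations`; THEOREMS ONLY (no definition, no named fact, no instance, no notation; net
Literature debt 0).  Cell `hodgecm-mathlib` (D-0151), FLOOR-0 programme P5a (D9op), H-row road (b).  SIBLING of ★
`LocalRingToClosureValuationSubring` (p794503, `exists_isLocalHom_comp_algebraMap_eq_toClosureValuationSubring`: the LOCAL-domain form,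
`D` local with `𝓞ᵥ → D` local ⇒ a local `𝓞ᵥ`-map `D → R`).  Here the NON-LOCAL packaging consumed by the scheme plumbing of road (b)
(`Motives/IntegralModelReductionSurjectiveOnClosedPoints`): for a domain `B` algebraic and torsion-free over `𝓞ᵥ = valuationSubringAtPrime K v`
(e.g. `Γ(U) ⧸ q` for an affine open `U` of a flat `𝓞ᵥ`-scheme of finite type and the prime `q` of ★ (b1)
`Literature.RingTheory.Flat.exists_prime_le_isAlgebraic_quotient`) and a PRIME ideal `𝔮` of `B` lying over `𝔪ᵥ`, there is a ring map
`e : B → R = closureValuationSubring (v.adicCompletion K)` over `𝓞ᵥ` whose CENTRE is `𝔮` (`e⁻¹(𝔪_R) = 𝔮`) — i.e. an `R`-point of `Spec B` with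
closed point `𝔮`; no `Localization.AtPrime 𝔮` instance bookkeeping is needed by the consumer.  The proof is organised independently of the
sibling (Chevalley on the local subring `range (B_𝔮 → K̄)`), and re-uses its bookkeeping lemma `smul_mem_nonunits_pointwise_smul_iff`.

* `exists_valuationSubring_algHom_mem_maximalIdeal_iff` — CHEVALLEY STEP inside `K̄`: an injective `𝓞ᵥ`-algebra map `j : B → K̄`
  (Mathlib `IsAlgClosed.lift`, injective by `Ideal.comap_ne_bot_of_algebraic_mem`) and a valuation ring `W ⊇ j(B)` of `K̄` whose centre on
  `ℤ̄_K` lies above `v`, with `b ∈ 𝔮 ↔ j b ∈ 𝔪_W` (Mathlib `LocalSubring.exists_le_valuationSubring` on `LocalSubring.range (B_𝔮 → K̄)`,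
  `IsLocalization.AtPrime.isUnit_to_map_iff` / `to_map_mem_maximal_iff`, ★ `mem_absIntegersCentre_iff`).
* `exists_ringHom_closureValuationSubring_comap_eq` — THE HEAD; from the Chevalley step by TRANSITIVITY of `Γ_K` on the primes above `v`
  (★ `HeightOneSpectrum.exists_smul_eq_of_mem_primesAbove_holds`, ★ `absIntegersCentre_smul`, ★ `eq_absIntegersValuationSubring_of_absIntegersCentre_eq`:
  `τ • W = ℤ̄_{𝔓₀}` for the prime `𝔓₀` of the chosen `ι : K̄ → \bar K_v`) and B-p09's local homomorphism `ι| : ℤ̄_{𝔓₀} → R`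
  (★ `isLocalHom_restrict_absClosureEmbedding_adicCompletion`); `…_of_isIntegral` — `B` integral, `𝔮` maximal.

References: [NeukirchANT1999] Ch. II §8 (8.1), Ch. I §9 Prop. (9.1); [SerreLocalFields1979] Ch. II §2 Prop. 3; [Liu2002] §10.1.3
Lemma 10.1.32 / Cor. 10.1.38; Stacks 00IA.  HC_CM is proved only modulo the 7 printed citations until rung 0 closes.
-/

set_option autoImplicit false

noncomputable section

open NumberField IsDedekindDomain IsDedekindDomain.HeightOneSpectrum IsLocalRing Field
open scoped Pointwise
open Literature.NumberTheory.GaloisRepresentations Literature.NumberTheory.DiophantineGeometry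

namespace Literature.NumberTheory.GaloisRepresentations

variable {K : Type} [Field K] [NumberField K] (v : HeightOneSpectrum (𝓞 K))

/-- **Chevalley step.** For a domain `B` algebraic and torsion-free over `𝓞ᵥ` and a prime `𝔮` of `B` over `𝔪ᵥ`, there are a
valuation ring `W` of `K̄` whose centre on `ℤ̄_K` lies above `v` and an injective `𝓞ᵥ`-algebra map `j : B → K̄` with `j(B) ⊆ W` and
`j⁻¹(𝔪_W) = 𝔮`: embed `B ↪ K̄` over `𝓞ᵥ` (`IsAlgClosed.lift`; injective by `Ideal.comap_ne_bot_of_algebraic_mem`), dominate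
the local subring `B_𝔮 ⊆ K̄` by a valuation ring (Chevalley, Mathlib `LocalSubring.exists_le_valuationSubring`), and read the centre
of `W` on `𝓞 K` through `𝔮 ∩ 𝓞ᵥ = 𝔪ᵥ` (`IsLocalization.AtPrime.to_map_mem_maximal_iff`).
[cite: NeukirchANT1999, Ch. II §8 (8.1)] -/
theorem exists_valuationSubring_algHom_mem_maximalIdeal_iff
    {B : Type} [CommRing B] [IsDomain B] [Algebra (valuationSubringAtPrime K v) B]
    [FaithfulSMul (valuationSubringAtPrime K v) B] [Algebra.IsAlgebraic (valuationSubringAtPrime K v) B]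
    (𝔮 : Ideal B) [𝔮.IsPrime] (h𝔮 : 𝔮.comap (algebraMap (valuationSubringAtPrime K v) B) = maximalIdeal (valuationSubringAtPrime K v)) :
    ∃ (W : ValuationSubring (AlgebraicClosure K)) (_ : absIntegersCentre W ∈ v.primesAbove)
      (j : B →ₐ[valuationSubringAtPrime K v] AlgebraicClosure K) (hj : ∀ b, j b ∈ W),
      Function.Injective j ∧ ∀ b, b ∈ 𝔮 ↔ (⟨j b, hj b⟩ : W) ∈ maximalIdeal W := by
  -- the composite structure map `𝓞ᵥ → K → K̄` (Mathlib's `AlgebraicClosure.instAlgebra` over the `𝓞ᵥ`-algebra `K`)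
  have hOK : ∀ a : valuationSubringAtPrime K v,
      algebraMap (valuationSubringAtPrime K v) (AlgebraicClosure K) a = algebraMap K (AlgebraicClosure K) (a : K) :=
    fun a => IsScalarTower.algebraMap_apply (valuationSubringAtPrime K v) K (AlgebraicClosure K) a
  haveI : FaithfulSMul (valuationSubringAtPrime K v) (AlgebraicClosure K) :=
    (faithfulSMul_iff_algebraMap_injective _ _).mpr fun a b h =>
      Subtype.ext ((algebraMap K (AlgebraicClosure K)).injective (by rwa [hOK, hOK] at h))
  -- (1) an injective `𝓞ᵥ`-embedding `j : B → K̄`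
  let j : B →ₐ[valuationSubringAtPrime K v] AlgebraicClosure K := IsAlgClosed.lift
  have hj : Function.Injective j := by
    rw [injective_iff_map_eq_zero]
    intro b hb
    by_contra hb0
    -- a non-zero algebraic element of the kernel would give a non-zero element of `𝓞ᵥ` in the kernel
    refine Ideal.comap_ne_bot_of_algebraic_mem (R := valuationSubringAtPrime K v) (I := RingHom.ker (j : B →+* AlgebraicClosure K))
      hb0 ((RingHom.mem_ker).2 hb) (Algebra.IsAlgebraic.isAlgebraic b) ?_
    rw [eq_bot_iff]
    intro a ha
    rw [Ideal.mem_comap, RingHom.mem_ker, AlgHom.coe_toRingHom, AlgHom.commutes] at ha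
    exact Ideal.mem_bot.2 ((map_eq_zero_iff _
      (FaithfulSMul.algebraMap_injective (valuationSubringAtPrime K v) (AlgebraicClosure K))).1 ha)
  -- (2) the local ring `B_𝔮 → K̄`
  have hS : ∀ s : 𝔮.primeCompl, IsUnit ((j : B →+* AlgebraicClosure K) s) := fun s =>
    isUnit_iff_ne_zero.2 ((map_ne_zero_iff _ hj).2 fun h => s.2 (h ▸ 𝔮.zero_mem))
  let f : Localization.AtPrime 𝔮 →+* AlgebraicClosure K := IsLocalization.lift (M := 𝔮.primeCompl) hS
  have hf_alg : ∀ b, f (algebraMap B (Localization.AtPrime 𝔮) b) = j b := fun b => IsLocalization.lift_eq hS b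
  have hinjloc : Function.Injective (algebraMap B (Localization.AtPrime 𝔮)) :=
    IsLocalization.injective (Localization.AtPrime 𝔮) 𝔮.primeCompl_le_nonZeroDivisors
  have hf : Function.Injective f := by
    rw [IsLocalization.lift_injective_iff]
    intro x y
    exact ⟨fun h => by rw [hinjloc h], fun h => by rw [hj h]⟩
  -- (3) Chevalley: a valuation ring `W` of `K̄` dominating `f(B_𝔮)`
  let A : LocalSubring (AlgebraicClosure K) := LocalSubring.range f
  obtain ⟨W, hAW, hloc⟩ := A.exists_le_valuationSubring
  have hAsub : A.toSubring = f.range := LocalSubring.range_toSubring f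
  have hmemA : ∀ z, f z ∈ A.toSubring := fun z => by rw [hAsub]; exact ⟨z, rfl⟩
  let fA : Localization.AtPrime 𝔮 →+* A.toSubring := f.codRestrict A.toSubring hmemA
  have hfA_inj : Function.Injective fA := fun x y h => hf (congrArg Subtype.val h)
  have hfA_surj : Function.Surjective fA := by
    rintro ⟨y, hy⟩
    rw [hAsub] at hy
    obtain ⟨z, rfl⟩ := hy
    exact ⟨z, rfl⟩
  -- units of `B_𝔮` ↔ units of `A` ↔ units of `W` (domination)
  have hunitA : ∀ x, IsUnit (fA x) ↔ IsUnit x := fun x => by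
    refine ⟨fun hu => ?_, fun hu => hu.map fA⟩
    obtain ⟨u, hu⟩ := hu
    obtain ⟨w, hw⟩ := hfA_surj (↑u⁻¹)
    refine IsUnit.of_mul_eq_one w (hfA_inj ?_)
    rw [map_mul, map_one, hw, ← hu, Units.mul_inv]
  have hunitW : ∀ y : A.toSubring, IsUnit (Subring.inclusion hAW y) ↔ IsUnit y := fun y =>
    ⟨fun hu => hloc.map_nonunit y hu, fun hu => hu.map _⟩
  have hmemW : ∀ b, j b ∈ W := fun b => by
    have h := (Subring.inclusion hAW (fA (algebraMap B _ b))).2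
    rwa [Subring.coe_inclusion, show ((fA (algebraMap B _ b) : A.toSubring) : AlgebraicClosure K) = j b from hf_alg b]
      at h
  have hkey : ∀ b, b ∈ 𝔮 ↔ (⟨j b, hmemW b⟩ : W) ∈ maximalIdeal W := fun b => by
    have h1 : IsUnit (algebraMap B (Localization.AtPrime 𝔮) b) ↔ b ∈ 𝔮.primeCompl :=
      IsLocalization.AtPrime.isUnit_to_map_iff (Localization.AtPrime 𝔮) 𝔮 b
    have h2 : Subring.inclusion hAW (fA (algebraMap B _ b)) = ⟨j b, hmemW b⟩ :=
      Subtype.ext (by rw [Subring.coe_inclusion]; exact hf_alg b)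
    have h3 : IsUnit (⟨j b, hmemW b⟩ : W) ↔ b ∈ 𝔮.primeCompl := by
      rw [← h1, ← hunitA, ← hunitW, h2]
      exact Iff.rfl
    rw [IsLocalRing.mem_maximalIdeal, mem_nonunits_iff, h3]
    exact (not_not (a := b ∈ 𝔮)).symm
  -- (4) the centre of `W` on `ℤ̄_K` lies above `v` (domination of `𝓞ᵥ`: `𝔮 ∩ 𝓞ᵥ = 𝔪ᵥ`)
  have hcentre : ∀ a : 𝓞 K, algebraMap (𝓞 K) (absIntegers (𝓞 K) K) a ∈ absIntegersCentre W ↔ a ∈ v.asIdeal := fun a => by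
    have e1 : ((algebraMap (𝓞 K) (absIntegers (𝓞 K) K) a : absIntegers (𝓞 K) K) : AlgebraicClosure K) =
        ((⟨j (algebraMap (valuationSubringAtPrime K v) B (algebraMap (𝓞 K) (valuationSubringAtPrime K v) a)),
          hmemW _⟩ : W) : AlgebraicClosure K) := by
      change algebraMap (𝓞 K) (AlgebraicClosure K) a =
        j (algebraMap (valuationSubringAtPrime K v) B (algebraMap (𝓞 K) (valuationSubringAtPrime K v) a))
      rw [AlgHom.commutes, hOK, IsScalarTower.algebraMap_apply (𝓞 K) K (AlgebraicClosure K),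
        IsScalarTower.algebraMap_apply (𝓞 K) (valuationSubringAtPrime K v) K]
      rfl
    rw [mem_absIntegersCentre_iff, e1, ValuationSubring.coe_mem_nonunits_iff, ← hkey, ← Ideal.mem_comap, h𝔮]
    exact IsLocalization.AtPrime.to_map_mem_maximal_iff (valuationSubringAtPrime K v) v.asIdeal a
  have hv : absIntegersCentre W ∈ v.primesAbove := by
    refine ⟨absIntegersCentre_isPrime W, ⟨Ideal.ext fun a => ?_⟩⟩
    rw [Ideal.under_def, Ideal.mem_comap, hcentre]
  exact ⟨W, hv, j, hmemW, hj, hkey⟩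

/-- **Every place above `v` of a domain algebraic over `𝓞ᵥ` comes from an `𝓞ᵥ`-embedding into `𝒪_{\bar K_v}`.**  Let `B` be a
domain, algebraic and torsion-free over `𝓞ᵥ = 𝓞_{K,(v)}` (e.g. of finite type with `Frac B / K` finite), and `𝔮` a prime ideal of
`B` lying over `𝔪ᵥ`.  Then there is a ring map `e : B → R = 𝒪_{\bar K_v}` over `𝓞ᵥ` (`e ∘ (𝓞ᵥ → B) = (𝓞ᵥ → R)`) whose centre is `𝔮`:
`e⁻¹(𝔪_R) = 𝔮`.  Proof: Chevalley (`exists_valuationSubring_algHom_mem_maximalIdeal_iff`) gives `W ∋ j(B)` with centre `𝔓 ∣ v`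
on `ℤ̄_K`; `Γ_K` is transitive on the primes above `v` (`exists_smul_eq_of_mem_primesAbove_holds`), so `τ • W = ℤ̄_{𝔓₀}` for the
prime `𝔓₀` of the chosen `ι : K̄ → \bar K_v`; compose `τ ∘ j` with the local homomorphism `ι| : ℤ̄_{𝔓₀} → R`.
[cite: NeukirchANT1999, Ch. II §8 (8.1)] [cite: SerreLocalFields1979, Ch. II §2 Prop. 3 and Cor. 2] -/
theorem exists_ringHom_closureValuationSubring_comap_eq
    {B : Type} [CommRing B] [IsDomain B] [Algebra (valuationSubringAtPrime K v) B]
    [FaithfulSMul (valuationSubringAtPrime K v) B] [Algebra.IsAlgebraic (valuationSubringAtPrime K v) B]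
    (𝔮 : Ideal B) [𝔮.IsPrime] (h𝔮 : 𝔮.comap (algebraMap (valuationSubringAtPrime K v) B) = maximalIdeal (valuationSubringAtPrime K v)) :
    ∃ e : B →+* closureValuationSubring (v.adicCompletion K),
      e.comp (algebraMap (valuationSubringAtPrime K v) B) = toClosureValuationSubring v ∧
        (maximalIdeal (closureValuationSubring (v.adicCompletion K))).comap e = 𝔮 := by
  obtain ⟨W, hv, j, hjW, -, hkey⟩ := exists_valuationSubring_algHom_mem_maximalIdeal_iff v 𝔮 h𝔮
  haveI := adicCompletionPrime_isMaximal K v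
  haveI : (absIntegersCentre W).IsMaximal := HeightOneSpectrum.isMaximal_of_mem_primesAbove hv
  -- transitivity of `Γ_K` on the primes above `v`: move the centre of `W` to `𝔓₀`
  obtain ⟨τ, hτ⟩ := HeightOneSpectrum.exists_smul_eq_of_mem_primesAbove_holds hv (adicCompletionPrime_mem_primesAbove K v)
  have hW : τ • W = absIntegersValuationSubring (adicCompletionPrime K v) :=
    eq_absIntegersValuationSubring_of_absIntegersCentre_eq _ _ (by rw [absIntegersCentre_smul, hτ])
  have hmem : ∀ b, τ • j b ∈ absIntegersValuationSubring (adicCompletionPrime K v) := fun b =>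
    hW ▸ ValuationSubring.smul_mem_pointwise_smul τ _ W (hjW b)
  -- `τ ∘ j : B → ℤ̄_{𝔓₀}` and `ι| : ℤ̄_{𝔓₀} → R`
  let jτ : B →+* absIntegersValuationSubring (adicCompletionPrime K v) :=
    ((MulSemiringAction.toRingHom (absoluteGaloisGroup K) (AlgebraicClosure K) τ).comp (j : B →+* AlgebraicClosure K)).codRestrict
      _ hmem
  let ιV : absIntegersValuationSubring (adicCompletionPrime K v) →+* closureValuationSubring (v.adicCompletion K) :=
    (absClosureEmbedding K (v.adicCompletion K)).toRingHom.restrict _ _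
      (forall_absClosureEmbedding_mem_closureValuationSubring_adicCompletion K v)
  haveI : IsLocalHom ιV := isLocalHom_restrict_absClosureEmbedding_adicCompletion K v
  refine ⟨ιV.comp jτ, RingHom.ext fun a => Subtype.ext ?_, Ideal.ext fun b => ?_⟩
  · -- over `𝓞ᵥ`: `ι (τ • (a : K̄)) = ι (a : K̄) = (𝓞ᵥ → R) a`
    change absClosureEmbedding K (v.adicCompletion K) (τ • j (algebraMap (valuationSubringAtPrime K v) B a)) = _
    rw [AlgHom.commutes, IsScalarTower.algebraMap_apply (valuationSubringAtPrime K v) K (AlgebraicClosure K),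
      absoluteGaloisGroup.smul_def, AlgEquiv.commutes, AlgHom.commutes]
    exact (RingHom.congr_fun (algebraMap_comp_toClosureValuationSubring v) a).symm
  · -- the centre: `ι|` is local, `τ •` transports non-units of `W` to non-units of `τ • W = ℤ̄_{𝔓₀}`
    rw [Ideal.mem_comap, IsLocalRing.mem_maximalIdeal, mem_nonunits_iff, RingHom.comp_apply, isUnit_map_iff ιV,
      ← mem_nonunits_iff, ← IsLocalRing.mem_maximalIdeal, ← ValuationSubring.coe_mem_nonunits_iff, hkey,
      ← ValuationSubring.coe_mem_nonunits_iff]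
    change τ • j b ∈ (absIntegersValuationSubring (adicCompletionPrime K v)).nonunits ↔ j b ∈ W.nonunits
    rw [← hW, smul_mem_nonunits_pointwise_smul_iff]

/-- **Finite (integral) case.**  For a domain `B` INTEGRAL and torsion-free over `𝓞ᵥ` (e.g. module-finite with injective structure map,
such as `Γ(Z, 𝒪_Z)` of an integral closed subscheme `Z` finite flat over `Spec 𝓞ᵥ`) EVERY maximal ideal `𝔮` lies over `𝔪ᵥ`
(`Ideal.isMaximal_comap_of_isIntegral_of_isMaximal`), so it is the centre of some `𝓞ᵥ`-map `e : B → 𝒪_{\bar K_v}`.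
[cite: NeukirchANT1999, Ch. II §8 (8.1)] -/
theorem exists_ringHom_closureValuationSubring_comap_eq_of_isIntegral
    {B : Type} [CommRing B] [IsDomain B] [Algebra (valuationSubringAtPrime K v) B]
    [FaithfulSMul (valuationSubringAtPrime K v) B] [Algebra.IsIntegral (valuationSubringAtPrime K v) B]
    (𝔮 : Ideal B) [𝔮.IsMaximal] :
    ∃ e : B →+* closureValuationSubring (v.adicCompletion K),
      e.comp (algebraMap (valuationSubringAtPrime K v) B) = toClosureValuationSubring v ∧
        (maximalIdeal (closureValuationSubring (v.adicCompletion K))).comap e = 𝔮 :=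
  haveI := Ideal.isMaximal_comap_of_isIntegral_of_isMaximal (R := valuationSubringAtPrime K v) 𝔮
  exists_ringHom_closureValuationSubring_comap_eq v 𝔮 (IsLocalRing.eq_maximalIdeal inferInstance)

end Literature.NumberTheory.GaloisRepresentations

end
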